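import Summits.QuantumFields.BalabanUV.Beta.D1BFx.GhostKernelComplete

/-!
# `BalabanUV.Beta.D1BFx.GhostHalfStencil` — road «BF-x» for binder row D1, slot (K), RE-CUT END row **(K2) FILE 1 «HALF-WORD STENCILS»**
# (K-END-RECUT-SPEC v1.1 ∕ §5 v1.2; ruling ρ-g7-5 ∕ F-g7-2; letter annex an3-g46 HALFWORD-AUDIT v1 201e01c5073f7bcf W3 ∕ W5 ∕ C1)

HONEST FRAMING (cell contract, verbatim): «discharging `BetaPertH` makes Bałaban's UV stability UNCONDITIONAL — a real constructive-QFT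
result; it is NOT the continuum limit and NOT the Clay problem.»  HONEST DEPENDENCY (verbatim): «continuum YM on T⁴ ⇐ BetaPertH ∧ nine
spine estimates (0/9 proved); BetaPertH ⇐ (D1) ∧ (D4) ∧ CAP+tail; G-an2-4 gates asym, D1 and NE2/3/4.»  THIS MODULE DISCHARGES NOTHING of
D1 / BetaPertH / the wall: [our object] DEFINITIONS in the T7-gh table API of `GhostStencil` ∕ `GhostKernelComplete` plus [folklore]
finite-support sockets.  NOT D1, NOT BetaPertH, NOT continuum, NOT Clay.

WHAT.  Under the (R2) bookkeeping of route T the exact ghost side of slot (K) is the HALF-covariant tower (`GhostHalfCovariant.hessT_ghost_halfCovariant`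
p244989, road instances `TorusGhostSideHalf` p246083 ∕ `GhostHalfCovariantRoad` p246014): its first-order word at the fine bond `b = (u, κ)`,
`t = u + e_κ`, is the HALF word `Xh_b := −Ê_bᵀD̂` — in site letters (audit W3, with `D̂f(b) = f(t) − f(u)` as in `StencilKernels.dzKer` and
`Ê_b = E_{b,t}`) `Xh_b = E_{tu} − E_{tt} = ½·Ljet_b + (½(E_tu + E_ut) − E_tt)`; its pure second-order word on the diagonal `b = b′` is `+Ê_bᵀD̂ = −Xh_b`
(audit W5); the mixed second word vanishes.  This file transcribes these as `MKer 4 Unit` stencils next to the typer's `ghCur` ∕ `ghCnt`: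
* §1 `xhSt κ u` (the half word), `symSt κ u` (its symmetric part), `xhSt_apply`, `symSt_apply`, the split `xhSt = ½•ghCur + symSt` pointwise
  (`xhSt_eq_half_ghCur_add_symSt`), fine-translation covariance `xhSt_translate` ∕ `symSt_translate`, localisation `biLoc_xhSt`, and the right-constant
  law `sum_xhSt_right_eq_zero` (audit C1: `Xh_b·1 = 0`, as a finite sum over the support).
* §2 the weighted families of the END's API: first order `XhS cK κ u := cK·xhSt κ u`, two-bond pure second `Xh2 cW κ u l u′ := [κ = l ∧ u = u′]·(−cW·xhSt κ u)`;
  sockets `XhS_translate`, `biLoc_XhS`, `Xh2_translate`, `biLoc_Xh2`, `Xh2_swap` (the `hEs`-shape leg-exchange symmetry of a diagonal family).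
* §3 the kernels: `XhQ n a cK cW := TOfGh n a (XhS cK) (tableRedF n (Xh2 cW))` and `fineHessXh n a cK cW := fineHessA (Ggh n a) (XhS cK) (Xh2 cW)` —
  NO root, NO generator weight `x₀`, NO averaging jet `cQ` (frozen `Q′`, ruling ρ-g7-6 [Q2]); the weights `cK`, `cW` are EXTERNAL (the END's CHECK-N0,
  as for `Sgh` ∕ `Wgh`).  The orientation match with leaf-03's covariant-gradient jets (`Ehat`) is made BY NAME in the dictionary, not here.
* §4 the A-row sockets of `XhQ`, verbatim the shape of `GhostKernelComplete` §1: `blockCovariant_XhQ`, `hess_eq_XhQ`, `exists_vertexFamily_XhS`,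
  `exists_vertexFamily₂_Xh2`, `absMoment₂_XhQ` (well-typed second moments), `exists_decay510_XhQ`.
Nothing is asserted about Bałaban's operator; nothing printed is used.
FILED BY the NE9 leaf seat `b2b-balaban-t4-ne9-formalise-leaf-01` (gen 39) as COURIER + MERGE under the owner's ACK l.26232: every declaration of
the road owner b2b-balaban-beta-d1-p2's draft `GhostHalfStencil.v1.owner-draft.lean` (sha16 412067bbe74ea0ee) is kept BYTE-IDENTICAL (statements and
proofs), and the courier's independent draft of the same SHAPE (journal l.26209; farm rc 0) contributes the ADDITIONS ONLY: `tip_ne_foot`,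
`xhSt_eq_zero_of_ne_tip` (finite support, row side), `hasSum_xhSt_right` (the `HasSum`-over-`ℤ⁴` form of audit C1 asked in the INTENT l.26177,
next to the owner's finite-set form), `xhSt_eq_half_ghCur_add_sym` (the W3 split at KERNEL level), `Xh2_eq_diagExt` ∕ `Xh2_self` (bridge:
`Xh2 cW = ReducedKernelSandwichBlock.diagExt (XhS (−cW))`, so `tableRedF_diagExt_apply` ∕ `wsum_diagExt_apply` ∕ `biLoc_diagExt` apply by ONE
rewrite), `XhQ_eq_TOfLeg` ∕ `XhQ_eq_hessKer`.
ABSOLUTE RULE (cell charter, verbatim): «No internally-minted statement may enter as a cited fact. Every hypothesis is either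
kernel-proved in this package or a verbatim quotation of a PUBLISHED theorem with page reference. The manuscript(s) under audit are NOT
citable for their own disputed steps — they are the thing under adjudication; programme-internal (2001/route/tribunal) claims are never
citable.»  Accordingly there is NO `def … : Prop` below, no citation is asserted, and no hypothesis of any theorem is a printed statement.
-/

namespace Summit.QuantumFields.BalabanUV.Beta.D1BFx.GhostHalfStencil

open Finset
open scoped BigOperators
open Literature.MathematicalPhysics.QuantumFieldTheory.Balaban1983to89
open Literature.MathematicalPhysics.QuantumFieldTheory.Balaban1983to89.Beta
open B12Sec2to5 (l1 l1_nonneg)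
open B6QGQDecay237 (deltaU deltaU_pos)
open B12Sec2to5 (Decay510)
open ExpKernelCalculus (Site MKer Decays BiLoc VertexFamily VertexFamily₂ shiftK BlockCovariant hess hessKer hess_eq_hessKer hdec_hessKer)
open DecimatedMomentSummable (AbsMoment₂)
open OneStepResolventKernel (decays_mono biLoc_mono)
open AffineAveraging (unitVec)
open Summit.QuantumFields.BalabanUV.Beta.D1BFx.GhostLeg (Ggh shiftK_Ggh_neg decays_Ggh const_nonneg)
open Summit.QuantumFields.BalabanUV.Beta.D1BFx.GhostStencil (ghCur ghCur_apply unitVec_ne_zero l1_unitVec l1_zero)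
open Summit.QuantumFields.BalabanUV.Beta.D1BFx.ReducedKernelF (vertexRedF TOfLeg TOfGh vertexFamily_vertexRedF' absMoment₂_TOfGh)
open Summit.QuantumFields.BalabanUV.Beta.D1BFx.GhostKernel (vertexRedF_translate_block)
open Summit.QuantumFields.BalabanUV.Beta.D1BFx.ReducedTableF (tableRedF vertexFamily₂_tableRedF' tableRedF_translate)
open Summit.QuantumFields.BalabanUV.Beta.D1BFx.ReducedKernelSandwichLeg (fineHessA)
open Summit.QuantumFields.BalabanUV.Beta.D1BFx.MomentTransferPeriodicEntry (EKer₂)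
open Summit.QuantumFields.BalabanUV.Beta.D1BFx.ReducedKernelSandwichBlock (diagExt diagExt_apply diagExt_self)

noncomputable section

/-! ## §1 The half word and its symmetric part -/

/-- [our object] **THE HALF WORD** at the fine bond `⟨u, u + e_κ⟩`, colour-stripped: `xhSt κ u x z = [x = u + e_κ][z = u] − [x = u + e_κ][z = u + e_κ]`
(= `E_tu − E_tt = −Ê_bᵀD̂`, audit W3).  A definition; asserts nothing. -/
def xhSt (κ : Fin 4) (u : Site 4) : MKer 4 Unit := fun x z _ _ =>
  (if x = u + unitVec κ ∧ z = u then (1 : ℝ) else 0) - (if x = u + unitVec κ ∧ z = u + unitVec κ then (1 : ℝ) else 0)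

/-- [our object] **THE SYMMETRIC PART OF THE HALF WORD**: `symSt κ u x z = ½([x = u + e_κ][z = u] + [x = u][z = u + e_κ]) − [x = u + e_κ][z = u + e_κ]`
(audit W3: `S_b = ½(E_tu + E_ut) − E_tt`).  A definition; asserts nothing. -/
def symSt (κ : Fin 4) (u : Site 4) : MKer 4 Unit := fun x z _ _ =>
  (1 / 2 : ℝ) * ((if x = u + unitVec κ ∧ z = u then (1 : ℝ) else 0) + (if x = u ∧ z = u + unitVec κ then (1 : ℝ) else 0))
    - (if x = u + unitVec κ ∧ z = u + unitVec κ then (1 : ℝ) else 0)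

variable (κ : Fin 4) (u : Site 4)

/-- [our object] Unfolding `xhSt`. -/
theorem xhSt_apply (x z : Site 4) (a b : Unit) : xhSt κ u x z a b =
    (if x = u + unitVec κ ∧ z = u then (1 : ℝ) else 0) - (if x = u + unitVec κ ∧ z = u + unitVec κ then (1 : ℝ) else 0) := rfl

/-- [our object] Unfolding `symSt`. -/
theorem symSt_apply (x z : Site 4) (a b : Unit) : symSt κ u x z a b =
    (1 / 2 : ℝ) * ((if x = u + unitVec κ ∧ z = u then (1 : ℝ) else 0) + (if x = u ∧ z = u + unitVec κ then (1 : ℝ) else 0))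
      - (if x = u + unitVec κ ∧ z = u + unitVec κ then (1 : ℝ) else 0) := rfl

/-- [folklore] **THE HALF WORD SPLITS** into half the antisymmetric current plus its symmetric part: `Xh_b = ½·Ljet_b + S_b` (audit W3, pointwise). -/
theorem xhSt_eq_half_ghCur_add_symSt (x z : Site 4) (a b : Unit) :
    xhSt κ u x z a b = (1 / 2 : ℝ) * ghCur κ u x z a b + symSt κ u x z a b := by
  rw [xhSt_apply, ghCur_apply, symSt_apply]; ring

/-- [folklore] The symmetric part is symmetric under exchange of the two legs. -/
theorem symSt_symm (x z : Site 4) (a b : Unit) : symSt κ u z x b a = symSt κ u x z a b := by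
  simp only [symSt_apply]
  rw [if_congr (and_comm (a := z = u + unitVec κ) (b := x = u)) (rfl : (1 : ℝ) = 1) (rfl : (0 : ℝ) = 0),
    if_congr (and_comm (a := z = u) (b := x = u + unitVec κ)) (rfl : (1 : ℝ) = 1) (rfl : (0 : ℝ) = 0),
    if_congr (and_comm (a := z = u + unitVec κ) (b := x = u + unitVec κ)) (rfl : (1 : ℝ) = 1) (rfl : (0 : ℝ) = 0)]
  ring

/-- [folklore] **FINE-TRANSLATION COVARIANCE** of the half word (every fine vector `v`): `xhSt κ (u + v) = shiftK (−v) (xhSt κ u)`. -/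
theorem xhSt_translate (v : Site 4) : xhSt κ (u + v) = shiftK (-v) (xhSt κ u) := by
  funext x z a b
  show xhSt κ (u + v) x z a b = xhSt κ u (x + -v) (z + -v) a b
  simp only [xhSt_apply, ← sub_eq_add_neg, sub_eq_iff_eq_add, add_right_comm u v (unitVec κ)]

/-- [folklore] Fine-translation covariance of the symmetric part. -/
theorem symSt_translate (v : Site 4) : symSt κ (u + v) = shiftK (-v) (symSt κ u) := by
  funext x z a b
  show symSt κ (u + v) x z a b = symSt κ u (x + -v) (z + -v) a b
  simp only [symSt_apply, ← sub_eq_add_neg, sub_eq_iff_eq_add, add_right_comm u v (unitVec κ)]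

/-- [folklore] **LOCALISATION SOCKET**: the half word is supported on `{x = u + e_κ, z ∈ {u, u + e_κ}}`, so `BiLoc (xhSt κ u) u u e^{2δ} δ` for every
`δ ≥ 0`. -/
theorem biLoc_xhSt {δ : ℝ} (hδ : 0 ≤ δ) : BiLoc (xhSt κ u) u u (Real.exp (2 * δ)) δ := by
  intro x z a b
  simp only [xhSt_apply]
  by_cases h1 : x = u + unitVec κ ∧ z = u
  · obtain ⟨hx, hz⟩ := h1
    have h2 : ¬(x = u + unitVec κ ∧ z = u + unitVec κ) := fun h =>
      unitVec_ne_zero κ (add_left_cancel (show u + unitVec κ = u + 0 by rw [add_zero, ← h.2]; exact hz))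
    rw [if_pos ⟨hx, hz⟩, if_neg h2, sub_zero, abs_one, hx, hz, add_sub_cancel_left, sub_self, l1_unitVec, l1_zero, add_zero,
      mul_one, ← Real.exp_add]
    exact Real.one_le_exp (by linarith)
  · by_cases h2 : x = u + unitVec κ ∧ z = u + unitVec κ
    · obtain ⟨hx, hz⟩ := h2
      rw [if_neg h1, if_pos ⟨hx, hz⟩, zero_sub, abs_neg, abs_one, hx, hz, add_sub_cancel_left, l1_unitVec, ← Real.exp_add]
      exact Real.one_le_exp (by linarith)
    · rw [if_neg h1, if_neg h2, sub_zero, abs_zero]; positivity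

/-- [folklore] **RIGHT CONSTANTS** (audit C1: `Xh_b·1 = 0`): for every row `x`, the half word sums to zero over any finite set of columns
containing `u` and `u + e_κ`. -/
theorem sum_xhSt_right_eq_zero (x : Site 4) (a b : Unit) (T : Finset (Site 4)) (hu : u ∈ T) (ht : u + unitVec κ ∈ T) :
    ∑ z ∈ T, xhSt κ u x z a b = 0 := by
  simp only [xhSt_apply, Finset.sum_sub_distrib]
  by_cases hx : x = u + unitVec κ
  · simp only [hx, true_and, Finset.sum_ite_eq' T, if_pos hu, if_pos ht, sub_self]
  · simp only [hx, false_and, if_false, Finset.sum_const_zero, sub_self]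

/-- [folklore] The tip is not the foot: `u + e_κ ≠ u` (addition, courier). -/
theorem tip_ne_foot : u + unitVec κ ≠ u := fun h => unitVec_ne_zero κ (by simpa using h)

/-- [folklore] **FINITE SUPPORT (ROW SIDE)**: the half word vanishes off the tip row `x = u + e_κ` (addition, courier). -/
theorem xhSt_eq_zero_of_ne_tip {x : Site 4} (hx : x ≠ u + unitVec κ) (z : Site 4) (a b : Unit) : xhSt κ u x z a b = 0 := by
  rw [xhSt_apply, if_neg (fun h => hx h.1), if_neg (fun h => hx h.1), sub_zero]

/-- [folklore] **RIGHT CONSTANTS, `HasSum` FORM** (audit C1 over all of `ℤ⁴`, the shape asked in the owner's INTENT l.26177): for every row `x`,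
`HasSum (fun z ↦ xhSt κ u x z a b) 0` — two nonzero terms, `+[x = t]` at `z = u` and `−[x = t]` at `z = t` (addition, courier). -/
theorem hasSum_xhSt_right (x : Site 4) (a b : Unit) : HasSum (fun z => xhSt κ u x z a b) 0 := by
  have hfun : (fun z => xhSt κ u x z a b) = fun z =>
      (if z = u then (if x = u + unitVec κ then (1 : ℝ) else 0) else 0)
        - (if z = u + unitVec κ then (if x = u + unitVec κ then (1 : ℝ) else 0) else 0) := by
    funext z
    by_cases hx : x = u + unitVec κ <;> simp [xhSt_apply, hx]
  have h := (hasSum_ite_eq u (if x = u + unitVec κ then (1 : ℝ) else 0)).sub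
    (hasSum_ite_eq (u + unitVec κ) (if x = u + unitVec κ then (1 : ℝ) else 0))
  rw [sub_self] at h
  rw [hfun]
  exact h

/-- [folklore] **THE W3 SPLIT AT KERNEL LEVEL**: `xhSt κ u = ½ • ghCur κ u + symSt κ u` (addition, courier; the pointwise form is
`xhSt_eq_half_ghCur_add_symSt`). -/
theorem xhSt_eq_half_ghCur_add_sym : xhSt κ u = (1 / 2 : ℝ) • ghCur κ u + symSt κ u := by
  funext x z a b
  exact xhSt_eq_half_ghCur_add_symSt κ u x z a b


/-! ## §2 The weighted families of the END's API -/

/-- [our object] **THE FIRST-ORDER HALF STENCIL WITH A REAL WEIGHT**: `XhS cK κ u := cK·xhSt κ u` (the slot of `GhostStencil.Sgh`; NO `cQ` part —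
frozen `Q′`).  A definition; asserts nothing; the identification of `cK` is the END's CHECK-N0. -/
def XhS (cK : ℝ) (κ : Fin 4) (u : Site 4) : MKer 4 Unit := fun x z a b => cK * xhSt κ u x z a b

/-- [our object] **THE TWO-BOND PURE-SECOND HALF FAMILY** with a real weight `cW`, diagonal in the bond: `Xh2 cW κ u l u′ := [κ = l ∧ u = u′]·(−cW·xhSt κ u)`
(audit W5: the pure-second half word is `+Ê_bᵀD̂ = −Xh_b`; the MIXED second word is zero and has no table).  A definition; asserts nothing. -/
def Xh2 (cW : ℝ) (κ : Fin 4) (u : Site 4) (l : Fin 4) (u' : Site 4) : MKer 4 Unit := fun x z a b =>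
  if κ = l ∧ u = u' then -(cW * xhSt κ u x z a b) else 0

variable (cK cW : ℝ)

/-- [our object] Unfolding `XhS`. -/
theorem XhS_apply (x z : Site 4) (a b : Unit) : XhS cK κ u x z a b = cK * xhSt κ u x z a b := rfl

/-- [our object] Unfolding `Xh2`. -/
theorem Xh2_apply (l : Fin 4) (u' x z : Site 4) (a b : Unit) :
    Xh2 cW κ u l u' x z a b = if κ = l ∧ u = u' then -(cW * xhSt κ u x z a b) else 0 := rfl

/-- [folklore] Fine-translation covariance of the weighted first-order family (every fine `v`; in particular block vectors `n•t`, the `hS` shape of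
`ReducedKernelF.blockCovariant_TOfGh`). -/
theorem XhS_translate (v : Site 4) : XhS cK κ (u + v) = shiftK (-v) (XhS cK κ u) := by
  funext x z a b
  simp only [XhS_apply, xhSt_translate, shiftK]

/-- [folklore] LOCALISATION SOCKET of the weighted first-order family: `BiLoc (XhS cK κ u) u u (|cK|·e^{2δ}) δ`. -/
theorem biLoc_XhS {δ : ℝ} (hδ : 0 ≤ δ) : BiLoc (XhS cK κ u) u u (|cK| * Real.exp (2 * δ)) δ := by
  intro x z a b
  rw [XhS_apply, abs_mul, mul_assoc]
  exact mul_le_mul_of_nonneg_left (biLoc_xhSt κ u hδ x z a b) (abs_nonneg _)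

/-- [folklore] Translation covariance of the two-bond family (the `hW` shape of `ReducedKernelF.blockCovariant_TOfGh`, every fine `t`). -/
theorem Xh2_translate (l : Fin 4) (u' t : Site 4) : Xh2 cW κ (u + t) l (u' + t) = shiftK (-t) (Xh2 cW κ u l u') := by
  funext x z a b
  show Xh2 cW κ (u + t) l (u' + t) x z a b = Xh2 cW κ u l u' (x + -t) (z + -t) a b
  rw [Xh2_apply, Xh2_apply, xhSt_translate]
  simp only [shiftK, add_left_inj]

/-- [folklore] LOCALISATION SOCKET of the two-bond family: `BiLoc (Xh2 cW κ u l u′) u u′ (|cW|·e^{2δ}) δ`. -/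
theorem biLoc_Xh2 {δ : ℝ} (hδ : 0 ≤ δ) (l : Fin 4) (u' : Site 4) : BiLoc (Xh2 cW κ u l u') u u' (|cW| * Real.exp (2 * δ)) δ := by
  intro x z a b
  rw [Xh2_apply]
  by_cases h : κ = l ∧ u = u'
  · rw [if_pos h, abs_neg, abs_mul, ← h.2, mul_assoc]
    exact mul_le_mul_of_nonneg_left (biLoc_xhSt κ u hδ x z a b) (abs_nonneg _)
  · rw [if_neg h, abs_zero]; positivity

/-- [folklore] **LEG-EXCHANGE SYMMETRY OF THE DIAGONAL FAMILY** (the `hEs` shape of the END): `Xh2 cW κ u l u′ = Xh2 cW l u′ κ u`. -/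
theorem Xh2_swap (l : Fin 4) (u' : Site 4) : Xh2 cW κ u l u' = Xh2 cW l u' κ u := by
  funext x z a b
  rw [Xh2_apply, Xh2_apply]
  by_cases h : κ = l ∧ u = u'
  · obtain ⟨h1, h2⟩ := h
    subst h1; subst h2
    simp only [and_self]
  · rw [if_neg h, if_neg (fun h' => h ⟨h'.1.symm, h'.2.symm⟩)]

/-- [folklore] **BRIDGE TO THE DIAGONAL-EXTENSION API**: `Xh2 cW = diagExt (XhS (−cW))` — the pure-second family IS the diagonal extension of the
`(−cW)`-weighted first-order family, so every generic `ReducedKernelSandwichBlock.diagExt` theorem (`tableRedF_diagExt_apply`, `wsum_diagExt_apply`,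
`biLoc_diagExt`, `diagExt_translate`) applies after ONE rewrite (addition, courier). -/
theorem Xh2_eq_diagExt : Xh2 cW = diagExt (XhS (-cW)) := by
  funext κ u l u' x z a b
  rw [Xh2_apply, diagExt_apply, XhS_apply, neg_mul]

/-- [our object] On the diagonal: `Xh2 cW κ u κ u = XhS (−cW) κ u` (addition, courier). -/
theorem Xh2_self : Xh2 cW κ u κ u = XhS (-cW) κ u := by
  rw [Xh2_eq_diagExt, diagExt_self]


/-! ## §3 The half-tower kernels of the re-cut END -/

/-- [our object] **THE HALF-TOWER ONE-SHOT GHOST KERNEL** at block size `n`, averaging weight `a`, stencil weight `cK`, contact weight `cW`: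
`XhQ n a cK cW := TOfGh n a (XhS cK) (tableRedF n (Xh2 cW))` — leaf-04's T7-gh triple with the HALF words (no root, no `x₀`, no `cQ`).
A DEFINITION; asserts nothing; NOT claimed to be Bałaban's (CHECK-N0). -/
def XhQ (n : ℕ) [NeZero n] (a cK cW : ℝ) : Fin 4 → Fin 4 → Site 4 → ℝ :=
  TOfGh n a (XhS cK) (tableRedF n (Xh2 cW))

/-- [our object] **THE FINE HALF-TOWER HESSIAN KERNEL**: `fineHessXh n a cK cW := fineHessA (Ggh n a) (XhS cK) (Xh2 cW)`.  A DEFINITION; asserts nothing. -/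
def fineHessXh (n : ℕ) [NeZero n] (a cK cW : ℝ) : EKer₂ 4 :=
  fineHessA (Ggh n a) (XhS cK) (Xh2 cW)

variable (n : ℕ) [NeZero n] (a : ℝ)

/-- [our object] Unfolding `XhQ`. -/
theorem XhQ_eq : XhQ n a cK cW = TOfGh n a (XhS cK) (tableRedF n (Xh2 cW)) := rfl

/-- [our object] Unfolding `fineHessXh`. -/
theorem fineHessXh_eq : fineHessXh n a cK cW = fineHessA (Ggh n a) (XhS cK) (Xh2 cW) := rfl

/-- [our object] `XhQ` over the generic leg: `XhQ n a cK cW = TOfLeg n (Ggh n a) (XhS cK) (tableRedF n (Xh2 cW))` (definitionally; addition, courier). -/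
theorem XhQ_eq_TOfLeg : XhQ n a cK cW = TOfLeg n (Ggh n a) (XhS cK) (tableRedF n (Xh2 cW)) := rfl

/-- [our object] `XhQ` as an2's `hessKer`: `XhQ n a cK cW = hessKer (Ggh n a) (vertexRedF n (XhS cK)) (tableRedF n (Xh2 cW))` (definitionally;
addition, courier). -/
theorem XhQ_eq_hessKer : XhQ n a cK cW = hessKer (Ggh n a) (vertexRedF n (XhS cK)) (tableRedF n (Xh2 cW)) := rfl


/-! ## §4 The A-row sockets of the half-tower kernel (mirrors `GhostKernelComplete` §1 for `PghQ`) -/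

/-- [folklore] **BLOCK COVARIANCE OF THE HALF-TOWER DATA** (`0 < a`). -/
theorem blockCovariant_XhQ (ha : 0 < a) : BlockCovariant (Ggh n a) (vertexRedF n (XhS cK)) (tableRedF n (Xh2 cW)) n :=
  ⟨fun t => shiftK_Ggh_neg n a ha t,
   fun μ y t => vertexRedF_translate_block n (fun κ' u t => XhS_translate κ' u cK ((n : ℤ) • t)) μ y t,
   fun μ y ν y' t => tableRedF_translate n (fun κ' u l' u' t => Xh2_translate κ' u cW l' u' ((n : ℤ) • t)) μ y ν y' t⟩

/-- [folklore] **BASE POINT**: `hess (Ggh n a) (vertexRedF n (XhS cK)) (tableRedF n (Xh2 cW)) μ y ν y′ = XhQ n a cK cW μ ν (y′ − y)`. -/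
theorem hess_eq_XhQ (ha : 0 < a) (μ : Fin 4) (y : Site 4) (ν : Fin 4) (y' : Site 4) :
    hess (Ggh n a) (vertexRedF n (XhS cK)) (tableRedF n (Xh2 cW)) μ y ν y' = XhQ n a cK cW μ ν (y' - y) :=
  hess_eq_hessKer (blockCovariant_XhQ (cK := cK) (cW := cW) (n := n) (a := a) ha) μ y ν y'

/-- [folklore] The dressed first-order half family is a vertex family with SOME constant and a positive rate. -/
theorem exists_vertexFamily_XhS : ∃ Cv δv : ℝ, 0 < δv ∧ VertexFamily (vertexRedF n (XhS cK)) n Cv δv := by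
  obtain ⟨Cv, δv, hδv, -, hV⟩ := vertexFamily_vertexRedF' n (fun κ' u => biLoc_XhS κ' u cK (le_of_lt one_pos)) one_pos
  exact ⟨Cv, δv, hδv, hV⟩

/-- [folklore] The dressed two-bond half family is a second-order vertex family with SOME constant and a positive rate. -/
theorem exists_vertexFamily₂_Xh2 : ∃ C2 δ2 : ℝ, 0 < δ2 ∧ VertexFamily₂ (tableRedF n (Xh2 cW)) n C2 δ2 := by
  obtain ⟨C2, δ2, hδ2, -, hW⟩ := vertexFamily₂_tableRedF' n (fun κ' u l' u' => biLoc_Xh2 κ' u cW (le_of_lt one_pos) l' u') one_pos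
  exact ⟨C2, δ2, hδ2, hW⟩

/-- [folklore] **THE HALF-TOWER KERNEL IS WELL-TYPED** — `AbsMoment₂ (XhQ n a cK cW μ ν)` for every channel, every `n ≥ 1`, every `a > 0`, all real weights. -/
theorem absMoment₂_XhQ (ha : 0 < a) (μ ν : Fin 4) : AbsMoment₂ (XhQ n a cK cW μ ν) := by
  obtain ⟨Cv, δv, hδv, hV⟩ := exists_vertexFamily_XhS (cK := cK) (n := n)
  obtain ⟨C2, δ2, hδ2, hW⟩ := exists_vertexFamily₂_Xh2 (cW := cW) (n := n)
  exact absMoment₂_TOfGh n a ha hV hδv hW hδ2 μ ν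

/-- [folklore] **(5.10)-SHAPE DECAY OF EVERY CHANNEL** of the half-tower kernel, with SOME constant and positive rate (per `n`). -/
theorem exists_decay510_XhQ (ha : 0 < a) : ∃ C δ : ℝ, 0 < δ ∧ ∀ μ ν : Fin 4, Decay510 (XhQ n a cK cW μ ν) C δ := by
  have hn1 : 1 ≤ n := NeZero.one_le
  obtain ⟨Cv, δv, hδv, hV⟩ := exists_vertexFamily_XhS (cK := cK) (n := n)
  obtain ⟨C2, δ2, hδ2, hW⟩ := exists_vertexFamily₂_Xh2 (cW := cW) (n := n)
  have hA := decays_Ggh n a ha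
  have hrate : 0 < deltaU 4 a / (4 * (n : ℝ)) := by
    have := deltaU_pos 4 ha
    have hn : (0 : ℝ) < n := by exact_mod_cast hn1
    positivity
  set δ' : ℝ := min (deltaU 4 a / (4 * (n : ℝ))) (min δv δ2) with hδ'
  have hδ'pos : 0 < δ' := lt_min hrate (lt_min hδv hδ2)
  have hCv : 0 ≤ Cv := (hV 0 0).nonneg ()
  have hC2 : 0 ≤ C2 := (hW 0 0 0 0).nonneg ()
  have hA' : Decays (Ggh n a) (2 / min 2 a) δ' := decays_mono hA (const_nonneg a ha) le_rfl (min_le_left _ _)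
  have hV' : VertexFamily (vertexRedF n (XhS cK)) n Cv δ' := fun μ y =>
    biLoc_mono (hV μ y) hCv ((min_le_right _ _).trans (min_le_left _ _))
  have hW' : VertexFamily₂ (tableRedF n (Xh2 cW)) n C2 δ' := fun μ y ν y' =>
    biLoc_mono (hW μ y ν y') hC2 ((min_le_right _ _).trans (min_le_right _ _))
  obtain ⟨C', δ'', hδ'', h⟩ := hdec_hessKer hA' hV' hW' hδ'pos hn1
  exact ⟨C', δ'', hδ'', fun μ ν => h μ ν⟩

end

end Summit.QuantumFields.BalabanUV.Beta.D1BFx.GhostHalfStencil
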